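import Mathlib
import Summits.KontsevichZagierPeriods.Zeta5Search.BrickBonusResidueLaw
import Summits.KontsevichZagierPeriods.Zeta5Search.BrickBlockWeight
import Summits.KontsevichZagierPeriods.Zeta5Search.BrickHoleCells

/-!
# BrickBonusWeights — in the regime `{n/p} ≥ 2/3` the block weight gains `p^B` and `W/p^B` stays ADMISSIBLE; the exact
centre gains `p^B` too (inputs for Krattenthaler–Rivoal's Théorème 5 bonus at odd primes; cell zeta5-irr)

HONEST FRAMING: systematic search; no irrationality claim unless certified. INSTRUMENT lemmas of the ζ(5)
census cell zeta5-irr (HOME `run/shared/lean/pub/zeta5-irr/`), filed by the engine seat zi-eng (g12); sequel of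
`BrickBonusResidueLaw` (steps P1–P4, P6 of `zi-eng/lean-g12/FINDINGS-g12.md` §3). Nothing here is about ζ(5); no
irrationality content; 0 nats/n; rung F-Z1 NOT moved.

## The regime and the statements (`p` odd, row `n = n₀ + Np`, `n₀ < p`, **`3n₀ ≥ 2p`** i.e. `{n/p} ≥ 2/3`)

* `carries_pos`: every ° digit `j₀ ≤ n₀` has `c_a + c_b = ⌊(n₀+j₀)/p⌋ + ⌊(2n₀−j₀)/p⌋ ≥ 1` (Krattenthaler–Rivoal's
  Lemme 8 `Φ_n ∣ C(n+j,n)C(2n−j,n)` at the bottom digit); hence every ° multiplier has `v(λ_j) ≤ exp(−B)`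
  (`lambda_bonus_le`, from `BrickResidueLawCirc.lambda_circ`).
* For a weight `g` admissible at level `L+1` ((I), (S_ε), (D)) the block weight `W = blockWeight A B ε p n₀ N g` has
  **`v(W(K)) ≤ exp(−B)`** (`blockWeight_bonus_le`), **`v(W(N−K)+W(K)) ≤ exp(−(L+1+B))`** (`blockWeight_bonus_reflect`),
  **`v(W(K')−W(K)) ≤ exp(−(e+B))`** for `p^e ∣ K−K'`, `1 ≤ e ≤ L` (`blockWeight_bonus_local`, via
  `BrickBonusResidueLaw.lambda_digit_local_bonus`) — so `W/p^B` is admissible for the row `N` at level `L`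
  (`BrickBlockWeight` gives the same three with `B` replaced by `1`).
* `centre_cell_bonus`, `centre_cellZero_bonus`: the exact-centre cell (`2k = n`, kernel `ε = 1`) has
  `v(p^{(L+1)(A−s)}c_{k,s}(n)) ≤ exp(−(L+1+B))`: it is `T ×` the `ε = 0` cell one depth lower, whose digit is either
  `n₀/2` (a ° digit of the `ε = 0` kernel with BOTH carries, `3n₀/2 ≥ p`: residue law with the bonus) or `(n₀+p)/2 > n₀`
  (a hole digit: `p ∣ C(n,k)` by Lucas, `BrickHoleCells`).
-/

namespace Summit.KontsevichZagierPeriods.Zeta5Search.BrickBonusWeights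

open Finset Nat WithZero
open Summit.KontsevichZagierPeriods.Zeta5Search.BrickTopCoefficient (cTop)
open Summit.KontsevichZagierPeriods.Zeta5Search.BrickLaurent (laurent cell laurent_zero)
open Summit.KontsevichZagierPeriods.Zeta5Search.BrickPartialFractions (cellZero)
open Summit.KontsevichZagierPeriods.Zeta5Search.BrickLambda (cTop_zero_ne_zero)
open Summit.KontsevichZagierPeriods.Zeta5Search.BrickHarmonicBlocks (hsum)
open Summit.KontsevichZagierPeriods.Zeta5Search.BrickDigitStepDZero (cellZero_eq)
open Summit.KontsevichZagierPeriods.Zeta5Search.BrickResidueLawMain (level_laurent_integral level_hsum_integral)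
open Summit.KontsevichZagierPeriods.Zeta5Search.BrickDigitStripCirc (centreCarry)
open Summit.KontsevichZagierPeriods.Zeta5Search.BrickResidueLawCirc (lambda_circ)
open Summit.KontsevichZagierPeriods.Zeta5Search.BrickLambdaDigit (lambda_reflect sub_digit)
open Summit.KontsevichZagierPeriods.Zeta5Search.BrickLevelReduction (blockWeight)
open Summit.KontsevichZagierPeriods.Zeta5Search.BrickLaurentValuation (laurent_centre)
open Summit.KontsevichZagierPeriods.Zeta5Search.BrickHoleCells (pow_mul_cell_valuation one_le_padicValNat_choose_of_mod_lt)
open Summit.KontsevichZagierPeriods.Zeta5Search.BrickBonusResidueLaw (residueLaw_circ_depth_bonus lambda_digit_local_bonus)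

noncomputable section

variable {p : ℕ} [Fact p.Prime]

/-! ## The regime `3 n₀ ≥ 2p`: every ° digit carries at least once -/

/-- **In the regime `{n/p} ≥ 2/3` every ° digit has a carry**: for `n₀ < p` with `3n₀ ≥ 2p` and `j₀ ≤ n₀`,
`c_a + c_b = ⌊(n₀+j₀)/p⌋ + ⌊(2n₀−j₀)/p⌋ ≥ 1` (`j₀ ≥ p − n₀` gives `c_a = 1`, else `2n₀ − j₀ ≥ 3n₀ − p + 1 > p`). This is
Krattenthaler–Rivoal's Lemme 8 (`Φ_n ∣ C(n+j,n)C(2n−j,n)`) at the bottom digit. -/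
theorem carries_pos {n₀ j₀ : ℕ} (h32 : 2 * p ≤ 3 * n₀) (hj₀ : j₀ ≤ n₀) :
    1 ≤ (n₀ + j₀) / p + (n₀ + (n₀ - j₀)) / p := by
  have hp : p.Prime := Fact.out
  rcases le_or_gt p (n₀ + j₀) with h | h
  · have : 1 ≤ (n₀ + j₀) / p := (Nat.one_le_div_iff hp.pos).2 h
    exact this.trans (Nat.le_add_right _ _)
  · have : 1 ≤ (n₀ + (n₀ - j₀)) / p := (Nat.one_le_div_iff hp.pos).2 (by omega)
    exact this.trans (Nat.le_add_left _ _)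

/-- `m = B c_a + B c_b + ε c_c ≥ B` in the regime. -/
theorem carryCount_ge {B ε n₀ j₀ c : ℕ} (h32 : 2 * p ≤ 3 * n₀) (hj₀ : j₀ ≤ n₀) :
    (B : ℤ) ≤ ((B * ((n₀ + j₀) / p) + B * ((n₀ + (n₀ - j₀)) / p) + ε * c : ℕ) : ℤ) := by
  have h := carries_pos (p := p) h32 hj₀
  have : B ≤ B * ((n₀ + j₀) / p) + B * ((n₀ + (n₀ - j₀)) / p) := by
    rw [← mul_add]; nlinarith
  exact_mod_cast this.trans (Nat.le_add_right _ _)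

/-- **Digit-locality with the bonus, block form**: for the ° cells `k₀ + Kp`, `k₀ + K'p` (`k₀ ≤ n₀`) of the row
`n₀ + Np` with `K'p = Kp + p^e q`, `e ≥ 1`: `v(λ' − λ) ≤ exp(−(B c_a + B c_b + e − 1))`. -/
theorem lambda_digit_local_bonus_std (hp2 : p ≠ 2) {A B ε n₀ N k₀ K K' e q : ℕ} (hA : Even A) (hn₀ : n₀ < p)
    (hk₀ : k₀ ≤ n₀) (hK : K ≤ N) (hK' : K' ≤ N) (hq : K' * p = K * p + p ^ e * q) (he : 1 ≤ e) {lam lam' : ℚ}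
    (hlam : lam * cTop A B 0 N K = cTop A B ε (n₀ + N * p) (k₀ + K * p))
    (hlam' : lam' * cTop A B 0 N K' = cTop A B ε (n₀ + N * p) (k₀ + K' * p)) :
    Rat.padicValuation p (lam' - lam) ≤
      exp (-((B * ((n₀ + k₀) / p) + B * ((n₀ + (n₀ - k₀)) / p) + (e - 1) : ℕ) : ℤ)) := by
  obtain ⟨m₀, rfl⟩ := Nat.exists_eq_add_of_le hk₀
  obtain ⟨M, rfl⟩ := Nat.exists_eq_add_of_le hK
  obtain ⟨M', hM'⟩ := Nat.exists_eq_add_of_le hK'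
  have hJM : K' + M' = K + M := hM'.symm
  rw [hM'] at hlam'
  have h := lambda_digit_local_bonus hp2 hJM hq he hA (by omega) hlam hlam'
  rwa [Nat.add_sub_cancel_left]

/-! ## The block weight in the regime: `p^B ∣ W`, and `W/p^B` is admissible one level down -/

section weight

variable (hp2 : p ≠ 2) {A B ε N n₀ L : ℕ} (hA : Even A) (hB : 1 ≤ B) (hε : ε ≤ 1) (hn₀ : n₀ < p)
  (h32 : 2 * p ≤ 3 * n₀)
  {g : ℕ → ℚ} (hgI : ∀ k, k ≤ n₀ + N * p → Rat.padicValuation p (g k) ≤ 1)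
  (hgS : ∀ k, k ≤ n₀ + N * p →
    Rat.padicValuation p (g (n₀ + N * p - k) + (-1) ^ ε * g k) ≤ exp (-((L : ℤ) + 1)))
  (hgD : ∀ e k k', 1 ≤ e → e ≤ L + 1 → k ≤ n₀ + N * p → k' ≤ n₀ + N * p → (p : ℤ) ^ e ∣ (k : ℤ) - k' →
    Rat.padicValuation p (g k' - g k) ≤ exp (-(e : ℤ)))
include hp2 hA hB hε hn₀ h32 hgI hgS hgD

omit hA hB hε hgI hgS hgD in
/-- The ° multiplier of the digit `k₀ ≤ n₀` in the block `K` has `v(λ) ≤ exp(−B)` in the regime. -/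
theorem lambda_bonus_le {k₀ K : ℕ} (hk₀ : k₀ ≤ n₀) (hK : K ≤ N) :
    Rat.padicValuation p (cTop A B ε (n₀ + N * p) (k₀ + K * p) / cTop A B 0 N K) ≤ exp (-(B : ℤ)) :=
  (lambda_circ hp2 (A := A) (B := B) (ε := ε) rfl rfl hn₀ hk₀ hK
    (div_mul_cancel₀ _ (cTop_zero_ne_zero hK A B))).trans (exp_le_exp.2 (by
      have := carryCount_ge (p := p) (B := B) (ε := ε) (c := centreCarry p (n₀ + N * p) (k₀ + K * p)) h32 hk₀
      linarith))

omit hA hB hε hgS hgD in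
/-- **`W(K) ≡ 0 (mod p^B)`** in the regime (termwise: `λ ≡ 0 (mod p^B)`). -/
theorem blockWeight_bonus_le {K : ℕ} (hK : K ≤ N) :
    Rat.padicValuation p (blockWeight A B ε p n₀ N g K) ≤ exp (-(B : ℤ)) := by
  rw [blockWeight]
  refine Valuation.map_sum_le _ fun k₀ hk₀ => ?_
  have hk₀' : k₀ ≤ n₀ := by have := mem_range.1 hk₀; omega
  have hkn : k₀ + K * p ≤ n₀ + N * p := by nlinarith
  rw [map_mul]
  calc _ ≤ 1 * exp (-(B : ℤ)) := mul_le_mul' (hgI _ hkn) (lambda_bonus_le hp2 hn₀ h32 hk₀' hK)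
    _ = _ := one_mul _

omit hB hgI hgD in
/-- **`W(N−K) + W(K) ≡ 0 (mod p^{L+1+B})`** in the regime. -/
theorem blockWeight_bonus_reflect {K : ℕ} (hK : K ≤ N) :
    Rat.padicValuation p (blockWeight A B ε p n₀ N g (N - K) + blockWeight A B ε p n₀ N g K) ≤
      exp (-((L : ℤ) + 1 + B)) := by
  have hp : p.Prime := Fact.out
  rw [blockWeight, blockWeight, ← Finset.sum_range_reflect (fun k₀ => g (k₀ + (N - K) * p) * _) (n₀ + 1),
    ← Finset.sum_add_distrib]
  refine Valuation.map_sum_le _ fun k₀ hk₀ => ?_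
  have hk₀' : k₀ ≤ n₀ := by have := mem_range.1 hk₀; omega
  have hkn : k₀ + K * p ≤ n₀ + N * p := by nlinarith
  rw [show n₀ + 1 - 1 - k₀ = n₀ - k₀ by omega, ← sub_digit (p := p) hk₀' hK, lambda_reflect hA B hε hk₀' hK,
    show g (n₀ + N * p - (k₀ + K * p)) * ((-1) ^ ε * (cTop A B ε (n₀ + N * p) (k₀ + K * p) / cTop A B 0 N K)) +
        g (k₀ + K * p) * (cTop A B ε (n₀ + N * p) (k₀ + K * p) / cTop A B 0 N K) =
      ((-1) ^ ε * (cTop A B ε (n₀ + N * p) (k₀ + K * p) / cTop A B 0 N K)) *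
        (g (n₀ + N * p - (k₀ + K * p)) + (-1) ^ ε * g (k₀ + K * p)) by
      rcases Nat.le_one_iff_eq_zero_or_eq_one.1 hε with h | h <;> subst h <;> ring, map_mul, map_mul, map_pow,
    Valuation.map_neg, map_one, one_pow, one_mul]
  exact (mul_le_mul' (lambda_circ hp2 (A := A) (B := B) (ε := ε) rfl rfl hn₀ hk₀' hK
    (div_mul_cancel₀ _ (cTop_zero_ne_zero hK A B))) (hgS _ hkn)).trans (by
      rw [← exp_add, exp_le_exp]
      have := carryCount_ge (p := p) (B := B) (ε := ε) (c := centreCarry p (n₀ + N * p) (k₀ + K * p)) h32 hk₀'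
      linarith)


omit hB hε hgS in
/-- **`W(K') ≡ W(K) (mod p^{e+B})`** in the regime, for blocks `K, K' ≤ N` with `p^e ∣ K − K'`, `1 ≤ e ≤ L`:
`g'λ' − gλ = g'(λ' − λ) + λ(g' − g)` with `v(λ' − λ) ≥ B + e` (`lambda_digit_local_bonus`), `v(λ) ≥ B`, `v(g' − g) ≥ e + 1`. -/
theorem blockWeight_bonus_local {e K K' : ℕ} (he : 1 ≤ e) (heL : e ≤ L) (hK : K ≤ N) (hK' : K' ≤ N)
    (hdvd : (p : ℤ) ^ e ∣ (K : ℤ) - K') :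
    Rat.padicValuation p (blockWeight A B ε p n₀ N g K' - blockWeight A B ε p n₀ N g K) ≤ exp (-((e : ℤ) + B)) := by
  have hp : p.Prime := Fact.out
  wlog hle : K ≤ K' generalizing K K'
  · rw [Valuation.map_sub_swap]
    exact this hK' hK (by rw [← neg_sub]; exact (dvd_neg).2 hdvd) (by omega)
  obtain ⟨d, rfl⟩ := Nat.exists_eq_add_of_le hle
  obtain ⟨q, hq⟩ : p ^ e ∣ d := by
    have : (p : ℤ) ^ e ∣ (d : ℤ) := by
      have h := (dvd_neg).2 hdvd
      rw [neg_sub] at h; push_cast at h; rwa [add_sub_cancel_left] at h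
    exact_mod_cast this
  rw [blockWeight, blockWeight, ← Finset.sum_sub_distrib]
  refine Valuation.map_sum_le _ fun k₀ hk₀ => ?_
  have hk₀' : k₀ ≤ n₀ := by have := mem_range.1 hk₀; omega
  have hkn : k₀ + K * p ≤ n₀ + N * p := by nlinarith
  have hkn' : k₀ + (K + d) * p ≤ n₀ + N * p := by nlinarith
  set lam : ℚ := cTop A B ε (n₀ + N * p) (k₀ + K * p) / cTop A B 0 N K with hlam
  set lam' : ℚ := cTop A B ε (n₀ + N * p) (k₀ + (K + d) * p) / cTop A B 0 N (K + d) with hlam'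
  have hg : Rat.padicValuation p (g (k₀ + (K + d) * p) - g (k₀ + K * p)) ≤ exp (-((e : ℤ) + 1)) := by
    have := hgD (e + 1) (k₀ + K * p) (k₀ + (K + d) * p) (by omega) (by omega) hkn hkn' ?_
    · exact_mod_cast this
    · rw [hq]; push_cast
      exact ⟨-(q : ℤ), by ring⟩
  have hll : Rat.padicValuation p (lam' - lam) ≤ exp (-((B : ℤ) + e)) := by
    have h := lambda_digit_local_bonus_std hp2 (A := A) (B := B) (ε := ε) (e := e + 1) (q := q) hA hn₀ hk₀' hK hK'
      (by rw [hq]; ring) (by omega) (div_mul_cancel₀ _ (cTop_zero_ne_zero hK A B))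
      (div_mul_cancel₀ _ (cTop_zero_ne_zero hK' A B))
    refine h.trans (exp_le_exp.2 ?_)
    have hc := carries_pos (p := p) h32 hk₀'
    have : B + e ≤ B * ((n₀ + k₀) / p) + B * ((n₀ + (n₀ - k₀)) / p) + (e + 1 - 1) := by
      rw [← mul_add]; have := Nat.mul_le_mul_left B hc; omega
    have : ((B + e : ℕ) : ℤ) ≤ ((B * ((n₀ + k₀) / p) + B * ((n₀ + (n₀ - k₀)) / p) + (e + 1 - 1) : ℕ) : ℤ) := by
      exact_mod_cast this
    push_cast at this ⊢
    linarith
  have hlv : Rat.padicValuation p lam ≤ exp (-(B : ℤ)) := lambda_bonus_le hp2 hn₀ h32 hk₀' hK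
  rw [show g (k₀ + (K + d) * p) * lam' - g (k₀ + K * p) * lam =
      g (k₀ + (K + d) * p) * (lam' - lam) + lam * (g (k₀ + (K + d) * p) - g (k₀ + K * p)) by ring]
  refine Valuation.map_add_le _ ?_ ?_
  · rw [map_mul]
    calc _ ≤ 1 * exp (-((B : ℤ) + e)) := mul_le_mul' (hgI _ hkn') hll
      _ = exp (-((e : ℤ) + B)) := by rw [one_mul]; congr 1; ring
  · rw [map_mul]
    calc _ ≤ exp (-(B : ℤ)) * exp (-((e : ℤ) + 1)) := mul_le_mul' hlv hg
      _ ≤ _ := by rw [← exp_add, exp_le_exp]; omega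

end weight

/-! ## The exact-centre cell in the regime -/

section centre

variable (hp2 : p ≠ 2) {A B L n₀ N : ℕ} (hAB : 2 * B ≤ A) (hB : 1 ≤ B) (hn₀ : n₀ < p) (hN : N < p ^ (L + 1))
  (h32 : 2 * p ≤ 3 * n₀)
include hp2 hAB hB hn₀ hN h32

/-- **The centre cell gains `p^B`** in the regime: for `2k = n = n₀ + Np`, `v(p^{(L+1)(A−s)}c_{k,s}(n)) ≤ exp(−(L+1+B))`.
The cell is `T ×` the `ε = 0` cell one depth lower; if the centre digit is `n₀/2 ≤ n₀` that cell is a ° cell of the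
`ε = 0` kernel with BOTH carries (`3n₀/2 ≥ p`), if it is `(n₀+p)/2 > n₀` it is a hole digit and `p ∣ C(n,k)`. -/
theorem centre_cell_bonus {k : ℕ} (hk : k ≤ n₀ + N * p) (hc : 2 * k = n₀ + N * p) (s : ℕ) :
    Rat.padicValuation p ((p : ℚ) ^ ((L + 1) * (A - s)) * cell A B 1 (n₀ + N * p) k s) ≤
      exp (-((L : ℤ) + 1 + B)) := by
  have hp : p.Prime := Fact.out
  have hn : n₀ + N * p < p ^ (L + 1 + 1) := by
    calc n₀ + N * p < p + N * p := by omega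
      _ = (N + 1) * p := by ring
      _ ≤ p ^ (L + 1) * p := Nat.mul_le_mul_right _ hN
      _ = p ^ (L + 1 + 1) := (pow_succ _ _).symm
  rcases Nat.eq_zero_or_pos (A - s) with h0 | h0
  · rw [cell, h0, (laurent_centre A B hc 0).2, mul_zero, map_zero]; exact _root_.zero_le
  obtain ⟨d, hd⟩ : ∃ d, A - s = d + 1 := ⟨A - s - 1, by omega⟩
  rw [cell, hd, (laurent_centre A B hc d).1, show (L + 1) * (d + 1) = (L + 1) + (L + 1) * d by ring, pow_add,
    mul_assoc, map_mul, map_pow, Rat.padicValuation_self, ← exp_nsmul, nsmul_eq_mul, mul_neg_one]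
  -- the digits of the centre
  set k₀ := k % p with hk₀
  set K := k / p with hK
  have hkd : k = k₀ + K * p := by rw [hk₀, hK, Nat.mod_add_div' k p]
  have hk₀p : k₀ < p := Nat.mod_lt _ hp.pos
  suffices h : Rat.padicValuation p ((p : ℚ) ^ ((L + 1) * d) * laurent A B 0 (n₀ + N * p) k d) ≤ exp (-(B : ℤ)) by
    refine (mul_le_mul' le_rfl h).trans ?_
    rw [← exp_add, exp_le_exp]; push_cast; omega
  rcases le_or_gt k₀ n₀ with hle | hgt
  · -- ° digit: `2k₀ = n₀`, both carries
    have hKN : K ≤ N := by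
      by_contra hlt
      have : (N + 1) * p ≤ K * p := Nat.mul_le_mul_right _ (by omega)
      nlinarith
    have h2k₀ : 2 * k₀ = n₀ := by
      have h1 : 2 * k₀ % p = n₀ % p := by
        have h1' : (2 * k) % p = (n₀ + N * p) % p := congrArg (· % p) hc
        rwa [hkd, show 2 * (k₀ + K * p) = 2 * k₀ + 2 * K * p by ring, Nat.add_mul_mod_self_right,
          Nat.add_mul_mod_self_right] at h1'
      rw [Nat.mod_eq_of_lt hn₀] at h1
      rcases Nat.lt_or_ge (2 * k₀) p with hl | hge
      · rwa [Nat.mod_eq_of_lt hl] at h1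
      · exfalso
        have h3 : 2 * k₀ - p = n₀ := by
          rw [← h1, eq_comm]
          have := Nat.mod_eq_sub_mod hge
          rw [this, Nat.mod_eq_of_lt (by omega)]
        omega
    set lam : ℚ := cTop A B 0 (n₀ + N * p) (k₀ + K * p) / cTop A B 0 N K with hlam
    have hmul : lam * cTop A B 0 N K = cTop A B 0 (n₀ + N * p) (k₀ + K * p) :=
      div_mul_cancel₀ _ (cTop_zero_ne_zero hKN A B)
    have hres := residueLaw_circ_depth_bonus hp2 (ε := 0) hAB rfl rfl hN hn₀ hle hKN (Or.inr rfl) hmul d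
    have hlv := lambda_circ hp2 (A := A) (B := B) (ε := 0) rfl rfl hn₀ hle hKN hmul
    have hm : (2 * B : ℤ) ≤ ((B * ((n₀ + k₀) / p) + B * ((n₀ + (n₀ - k₀)) / p) +
        0 * centreCarry p (n₀ + N * p) (k₀ + K * p) : ℕ) : ℤ) := by
      have hca : 1 ≤ (n₀ + k₀) / p := (Nat.one_le_div_iff hp.pos).2 (by omega)
      have hcb : 1 ≤ (n₀ + (n₀ - k₀)) / p := (Nat.one_le_div_iff hp.pos).2 (by omega)
      have : 2 * B ≤ B * ((n₀ + k₀) / p) + B * ((n₀ + (n₀ - k₀)) / p) := by nlinarith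
      exact_mod_cast this.trans (Nat.le_add_right _ _)
    rw [← hkd] at hres hlv
    have hmain : Rat.padicValuation p (lam * ((p : ℚ) ^ (L * d) * laurent A B 0 N K d)) ≤ exp (-(B : ℤ)) := by
      rw [map_mul]
      calc _ ≤ exp (-((B * ((n₀ + k₀) / p) + B * ((n₀ + (n₀ - k₀)) / p) +
            0 * centreCarry p (n₀ + N * p) k : ℕ) : ℤ)) * 1 :=
            mul_le_mul' hlv (level_laurent_integral hp2 hAB hN hKN d)
        _ ≤ _ := by rw [mul_one, exp_le_exp]; rw [← hkd] at hm; linarith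
    rw [← hkd] at hm
    have hres' : Rat.padicValuation p ((p : ℚ) ^ ((L + 1) * d) * laurent A B 0 (n₀ + N * p) k d -
        lam * ((p : ℚ) ^ (L * d) * laurent A B 0 N K d)) ≤ exp (-(B : ℤ)) :=
      hres.trans (exp_le_exp.2 (by linarith [Int.natCast_nonneg L]))
    have h := Valuation.map_add_le _ hres' hmain
    rwa [sub_add_cancel] at h
  · -- hole digit: `p ∣ C(n,k)` (Lucas at digit 0)
    have hmod : (n₀ + N * p) % p < k % p := by
      rw [Nat.add_mul_mod_self_right, Nat.mod_eq_of_lt hn₀]; omega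
    have hv := one_le_padicValNat_choose_of_mod_lt (p := p) hk hmod
    have h := pow_mul_cell_valuation hp2 hAB (ε := 0) (L := L + 1) hn hk (Or.inr rfl) ((L + 1) * d) (s + 1)
    rw [cell, show A - (s + 1) = d by omega] at h
    refine h.trans (exp_le_exp.2 ?_)
    have hv' : (1 : ℤ) ≤ (padicValNat p ((n₀ + N * p).choose k) : ℤ) := by exact_mod_cast hv
    have hBA : (B : ℤ) ≤ A := by exact_mod_cast (show B ≤ A by omega)
    simp only [Nat.cast_mul, Nat.cast_add, Nat.cast_one]
    nlinarith [Int.natCast_nonneg L, Int.natCast_nonneg d, Int.natCast_nonneg A,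
      mul_le_mul_of_nonneg_left hv' (Int.natCast_nonneg A)]

/-- **The centre harmonic cell gains `p^B`** in the regime: `v(p^{(L+1)A}cell^{(0)}_k(n)) ≤ exp(−(L+1+B))` (`2k = n`). -/
theorem centre_cellZero_bonus {k : ℕ} (hk : k ≤ n₀ + N * p) (hc : 2 * k = n₀ + N * p) :
    Rat.padicValuation p ((p : ℚ) ^ ((L + 1) * A) * cellZero A B 1 (n₀ + N * p) k) ≤ exp (-((L : ℤ) + 1 + B)) := by
  have hp : p.Prime := Fact.out
  have hn : n₀ + N * p < p ^ (L + 1 + 1) := by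
    calc n₀ + N * p < p + N * p := by omega
      _ = (N + 1) * p := by ring
      _ ≤ p ^ (L + 1) * p := Nat.mul_le_mul_right _ hN
      _ = p ^ (L + 1 + 1) := (pow_succ _ _).symm
  have hklt : k < p ^ (L + 1 + 1) := lt_of_le_of_lt hk hn
  rw [cellZero_eq, mul_neg, Valuation.map_neg, Finset.mul_sum]
  refine Valuation.map_sum_le _ fun s hs => ?_
  have hs' := mem_Icc.1 hs
  rw [show (p : ℚ) ^ ((L + 1) * A) * (cell A B 1 (n₀ + N * p) k s * hsum s k) =
      ((p : ℚ) ^ ((L + 1) * (A - s)) * cell A B 1 (n₀ + N * p) k s) * ((p : ℚ) ^ ((L + 1) * s) * hsum s k) by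
    rw [show (L + 1) * A = (L + 1) * (A - s) + (L + 1) * s by rw [← mul_add, Nat.sub_add_cancel hs'.2], pow_add]; ring,
    map_mul]
  calc _ ≤ exp (-((L : ℤ) + 1 + B)) * 1 :=
        mul_le_mul' (centre_cell_bonus hp2 hAB hB hn₀ hN h32 hk hc s) (level_hsum_integral hklt s)
    _ = _ := mul_one _

end centre

end

end Summit.KontsevichZagierPeriods.Zeta5Search.BrickBonusWeights
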